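import Mathlib.Tactic.Linarith
import Mathlib.Tactic.NormNum
import Mathlib.Tactic.Ring
import HarnessLib

/-!
# The (0,1) cell of the ι-window, XXXV: the product ground `B₁ × B₂`, XXII — THE CORNER VI: LEMMA MULT, PROPOSITION GEN-SPLIT,
# LEMMA SOC, THEOREM II-VOID⁺⁺, LEMMA P′-BUDGET (report [XXXV] `H2-ZERO-ONE-35.md` §§2–6): arithmetic shadows

Family `hodge`, b2b cell `hweil` (helper of item stmt-HodgeConjecture-2524). Report
`run/shared/lean/b2b/hodge-weil/b2b-hweil-pv1-g47/H2-ZERO-ONE-35.md` ([XXXV]). Context ([XXXIV] §§5–7, 13): a partner `𝓠` of (Q-RES) on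
`H = B₁ × C₂` is the Hartshorne–Serre extension of `𝓘_{W′} ⊗ (N₄ ⊠ λ₄)` by `N₃ ⊠ λ₃` along an l.c.i. curve `W′` with
`ω_{W′} ≅ Ω|_{W′}`, `Ω := ω_H ⊗ 𝓛` of class `(n′ − 2n₃)θ₁ + (6 − 2d₃)f′`; a component `Γ` of `W′` of H-class `αϖ′ + βf′θ₁` has
`Ω·Γ = 2β(n′ − 2n₃) + α(6 − 2d₃)` (LEMMA MULT: `≤ 1` forces a multiple component); the generic fibre `E_a` is an extension of `λ₄` by `λ₃`
with class in `H¹(C₂, λ₃λ₄⁻¹)`, `deg = 2d₃ − 4` (PROPOSITION GEN-SPLIT: zero for `d₃ ≥ 4`); the socle of `ω_{W′}(2S)` on an S-line is `K₁³`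
(`h⁰ = 5`, invariant part `1` by Lefschetz `L = −3`) (LEMMA SOC); the cell margins of THEOREM II-VOID⁺⁺ and the point budget of LEMMA P′-BUDGET
(`|P′| = 2μ′ + 2(a₁ − n′)(a₂ − 2) − 4n′`). The theorems below record exactly these integer identities and inequalities. None of them claims
geometry. HONEST FRAMING: census work inside the ladder's H2 test ((0,1) cell) on the SPECIAL fourfold `X₀`; nothing here is a rung; no case of
the Hodge conjecture is proved; no statement of [Markman 2025] / [Perry 2026] / [EdGFS 2025] is used.
-/

-- mandated namespace `Summit.HodgeConjecture.HodgeConjecture.…` (Problem = Summit) trips `linter.dupNamespace`; the lakefile disables it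
-- tree-wide (weak option), restated here so stand-alone elaboration is warning-free too.
set_option linter.dupNamespace false

namespace Summit.HodgeConjecture.HodgeConjecture.WeilTypeLadder

section ProductGroundTwentyTwo

/-- **[XXXV] 2.1–2.2 (LEMMA MULT, the sign of the canonical degree).** With `Ω·Γ = 2β(n′ − 2n₃) + α(6 − 2d₃)` for a component of H-class
`(α, β)`, `α, β ≥ 0`: if `d₃ ≥ 3` the vertical coefficient `6 − 2d₃` is `≤ 0`; if `2n₃ ≥ n′` the horizontal coefficient is `≤ 0`; under both,
`Ω·Γ ≤ 0 < 2`, so no component can be generically reduced (a reduced component needs `Ω·Γ ≥ 2p_a − 2 ≥ 2`). For a vertical fibre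
(`α = 1`, `β = 0`) only `d₃ ≥ 3` is needed. [`nlinarith` / `omega`] -/
theorem pg22_mult_signs :
    (∀ d₃ : ℤ, 3 ≤ d₃ → 6 - 2 * d₃ ≤ 0) ∧
    (∀ n' n₃ β : ℤ, n' ≤ 2 * n₃ → 0 ≤ β → 2 * β * (n' - 2 * n₃) ≤ 0) ∧
    (∀ n' n₃ d₃ α β : ℤ, n' ≤ 2 * n₃ → 3 ≤ d₃ → 0 ≤ α → 0 ≤ β →
        2 * β * (n' - 2 * n₃) + α * (6 - 2 * d₃) ≤ 0 ∧ ¬ (2 ≤ 2 * β * (n' - 2 * n₃) + α * (6 - 2 * d₃))) ∧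
    (∀ d₃ : ℤ, 3 ≤ d₃ → ¬ (2 ≤ 2 * (0 : ℤ) * (10 - 2 * 10) + 1 * (6 - 2 * d₃))) := by
  refine ⟨fun d₃ h => by omega, fun n' n₃ β h hb => by nlinarith, fun n' n₃ d₃ α β h1 h2 h3 h4 => ?_, fun d₃ h => by omega⟩
  have e1 : 2 * β * (n' - 2 * n₃) ≤ 0 := by nlinarith
  have e2 : α * (6 - 2 * d₃) ≤ 0 := by nlinarith
  exact ⟨by linarith, by linarith⟩

/-- **[XXXV] 2.3 (the type-1 canonical degrees).** For RB-22 type 1 (`n′ = 10`): an S-line (`α = 0`, `β = 1`) has `Ω·Γ = 20 − 4n₃`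
(`= −20` for `n₃ = 10`, `≤ −8` for `n₃ ≥ 7`, `≥ 4` for `n₃ ≤ 4`); a vertical fibre has `6 − 2d₃` (`= 0` at `d₃ = 3`); the total is
`−2χ(𝒪_{W′}) = (6 − 2d₃)·W′·f′ + (10 − 2n₃)·W′·S`, e.g. `(n₃, d₃) = (10, 3)`: `W′·f′ = 70`, `W′·S = 104`, `χ(𝒪_{W′}) = 520`. [`norm_num`/`omega`] -/
theorem pg22_mult_type1 :
    (∀ n₃ : ℤ, 2 * 1 * (10 - 2 * n₃) + 0 * (6 - 2 * (3 : ℤ)) = 20 - 4 * n₃) ∧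
    ((20 : ℤ) - 4 * 10 = -20) ∧ (∀ n₃ : ℤ, 7 ≤ n₃ → 20 - 4 * n₃ ≤ -8) ∧ (∀ n₃ : ℤ, n₃ ≤ 4 → 4 ≤ 20 - 4 * n₃) ∧
    ((6 : ℤ) - 2 * 3 = 0) ∧
    ((70 : ℤ) - 2 * 10 * (10 - 10) = 70 ∧ (2 : ℤ) * (62 - 10 * (4 - 3) - (10 - 10) * 3) = 104 ∧
      (6 - 2 * (3 : ℤ)) * 70 + (10 - 2 * 10) * 104 = -2 * 520) := by
  refine ⟨fun n₃ => by ring, by norm_num, fun n₃ h => by omega, fun n₃ h => by omega, by norm_num, by norm_num⟩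

/-- **[XXXV] 3.1 (PROPOSITION GEN-SPLIT, the cohomological threshold).** The generic fibre `E_a` (`a ∉ p₁(W′)`) is an extension of `λ₄` by `λ₃`
with class in `H¹(C₂, ξ)`, `ξ = λ₃λ₄⁻¹`, `deg ξ = d₃ − (4 − d₃) = 2d₃ − 4`; on the genus-2 curve `C₂`, `H¹(ξ) = 0` once `deg ξ ≥ 3 = 2g − 1`,
i.e. for `d₃ ≥ 4`, and then `h⁰(ξ) = deg ξ − 1 = 2d₃ − 5 ≥ 3`; `d₃ = 3` gives `deg ξ = 2 = 2g − 2` (split unless `ξ = K₂`); `d₃ ≤ 2` gives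
`deg ξ ≤ 0` — the band (Q-RES-ss), not covered. [`omega`] -/
theorem pg22_gensplit_threshold :
    (∀ d₃ : ℤ, d₃ - (4 - d₃) = 2 * d₃ - 4) ∧
    (∀ d₃ : ℤ, (3 ≤ 2 * d₃ - 4 ↔ 4 ≤ d₃)) ∧
    (∀ d₃ : ℤ, 4 ≤ d₃ → (2 * d₃ - 4) - 1 = 2 * d₃ - 5 ∧ 3 ≤ 2 * d₃ - 5) ∧
    ((2 : ℤ) * 3 - 4 = 2 * 2 - 2) ∧ (∀ d₃ : ℤ, d₃ ≤ 2 → 2 * d₃ - 4 ≤ 0) := by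
  refine ⟨fun d₃ => by ring, fun d₃ => ⟨fun h => by omega, fun h => by omega⟩, fun d₃ h => ⟨by ring, by omega⟩, by norm_num,
    fun d₃ h => by omega⟩

/-- **[XXXV] 4.2 (LEMMA SOC, the socle on an S-line and on a vertical fibre).** On an S-line `Γ = C₁ × {z}` the socle of `ω_{W′}(2S)` is
`ω_Γ ⊗ 𝒪_H(2S)|_Γ = K₁ ⊗ K₁² = K₁³`: degree `3·2 = 6`, `h⁰ = 6 + 1 − 2 = 5` (Riemann–Roch, `6 > 2g − 2`); holomorphic Lefschetz for the
hyperelliptic involution (six fixed points, character `(−1)³ = −1` on `K³`, denominator `1 − (−1) = 2`): `L = 6·(−1)/2 = −3`, hence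
`(h⁰₊, h⁰₋) = ((5 − 3)/2, (5 + 3)/2) = (1, 4)`; a free `ι`-orbit pair of lines contributes `5` invariants. On a vertical fibre the socle is
`K₂` (`S·Γ = 0`, trivial twist of character `+1`): `h⁰ = 2` and the hyperelliptic involution acts by `−1` on `H⁰(K₂)` (trace `−2`), so
`(h⁰₊, h⁰₋) = ((2 − 2)/2, (2 + 2)/2) = (0, 2)`; a free pair of vertical fibres contributes `2`. The last clause records `SOC⁺ = 5f + w ≥ 0`.
[`norm_num` / `omega`] -/
theorem pg22_socle_counts :
    ((3 : ℤ) * 2 = 6 ∧ (6 : ℤ) + 1 - 2 = 5 ∧ (6 : ℤ) * (-1) = 2 * (-3) ∧ ((5 : ℤ) + (-3) = 2 * 1) ∧ ((5 : ℤ) - (-3) = 2 * 4)) ∧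
    ((-1 : ℤ) ^ 3 = -1 ∧ (1 : ℤ) - (-1) = 2) ∧
    ((2 : ℤ) + (-2) = 2 * 0 ∧ (2 : ℤ) - (-2) = 2 * 2) ∧
    (∀ f w : ℤ, 0 ≤ f → 0 ≤ w → 0 ≤ 5 * f + w) := by
  refine ⟨by norm_num, by norm_num, by norm_num, fun f w hf hw => by omega⟩

/-- **[XXXV] 4.2 (c)–(d) (socle degrees on the other components).** A curve of S-class `(v, h)` on `S = C₁ × C₂` has
`2p_a − 2 = 2vh + 2v + 2h` (adjunction, `K_S` of bidegree `(2,2)`), so `p_a = vh + v + h + 1`, and `χ(ω_Γ(2S|_Γ)) = (2p_a − 2 + 4h) + 1 − p_a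
= vh + v + 5h` (`≥ 16` for `v, h ≥ 2`). For a vertical fibre OUTSIDE `S` the direct socle `K_Γ ⊗ Ω⁻¹(−2S)|_Γ` has degree
`2 − (6 − 2d₃) − 0 = 2d₃ − 4`, `h⁰ = 2d₃ − 5` for `d₃ ≥ 4`. [`ring` / `nlinarith` / `omega`] -/
theorem pg22_socle_degrees :
    (∀ v h : ℤ, 2 * (v * h + v + h + 1) - 2 = 2 * v * h + 2 * v + 2 * h) ∧
    (∀ v h : ℤ, (2 * (v * h + v + h + 1) - 2 + 4 * h) + 1 - (v * h + v + h + 1) = v * h + v + 5 * h) ∧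
    (∀ v h : ℤ, 2 ≤ v → 2 ≤ h → 16 ≤ v * h + v + 5 * h) ∧
    (∀ d₃ : ℤ, (2 : ℤ) - (6 - 2 * d₃) - 0 = 2 * d₃ - 4) ∧ (∀ d₃ : ℤ, 4 ≤ d₃ → (2 * d₃ - 4) + 1 - 2 = 2 * d₃ - 5 ∧ 1 ≤ 2 * d₃ - 5) := by
  refine ⟨fun v h => by ring, fun v h => by ring, fun v h hv hh => by nlinarith, fun d₃ => by ring, fun d₃ h => ⟨by ring, by omega⟩⟩

/-- **[XXXV] 4.4 (THEOREM II-VOID⁺⁺, the cells).** Type 1, `n₃ = n′ = 10`, `d₃ = 3` (`MAIN = 65·3 − 39 = 156`,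
`Λ⁺ = 18h′ + (a₂ − 2)v′ + 2v′`, `OB = 0`): the cell `(a₁, a₂) = (21, 11)` (`v′ = 1`, `h′ = 8`) has margin `156 − (144 + 9 + 2) = 1` and is
VOID as soon as `SOC⁺ ≥ 1`, which one forced S-line gives; the cell `(20, 12)` (`v′ = 0`, `h′ = 9`) has margin `156 − 162 = −6` and, for a
REDUCED `D′` (`h′ = 2f + w`, `w ≤ 6` fixed lines, `w` odd), `SOC⁺ = 5f + w ≥ 15`, margin `≥ 9 ≥ 2`; likewise `(9, 3, 19, 10)`
(`MAIN = 100`, margin `−8`, `h′ = 7`: `5f + w ≥ 10`) and `(9, 4, 19, 14)` (`MAIN = 142`, margin `−11`, `h′ = 10`: `5f + w ≥ 16`).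
[`norm_num` / `omega`] -/
theorem pg22_iivoidpp_cells :
    ((65 : ℤ) * 3 - 39 = 156 ∧ (4 * 10 - 2 * 10 - 2 : ℤ) = 18) ∧
    ((156 : ℤ) - (18 * 8 + (11 + 3 - 5) * 1 + 2 * 1) = 1 ∧ ∀ s : ℤ, 1 ≤ s → 2 ≤ 1 + s) ∧
    ((156 : ℤ) - 18 * 9 = -6 ∧ ∀ f w : ℤ, 0 ≤ f → 0 ≤ w → w ≤ 6 → 2 * f + w = 9 → 15 ≤ 5 * f + w ∧ 2 ≤ -6 + (5 * f + w)) ∧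
    ((42 : ℤ) * 3 - 26 = 100 ∧ (100 : ℤ) - ((4 * 9 - 20 - 2) * 7 + (10 + 3 - 5) * 1 + 2 * 1) = -8 ∧
      ∀ f w : ℤ, 0 ≤ f → 0 ≤ w → w ≤ 6 → 2 * f + w = 7 → 10 ≤ 5 * f + w ∧ 2 ≤ -8 + (5 * f + w)) ∧
    ((42 : ℤ) * 4 - 26 = 142 ∧ (142 : ℤ) - ((4 * 9 - 20 - 2) * 10 + (14 + 4 - 5) * 1 + 0) = -11 ∧
      ∀ f w : ℤ, 0 ≤ f → 0 ≤ w → w ≤ 6 → 2 * f + w = 10 → 16 ≤ 5 * f + w ∧ 2 ≤ -11 + (5 * f + w)) := by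
  refine ⟨by norm_num, ⟨by norm_num, fun s hs => by omega⟩, ⟨by norm_num, fun f w hf hw h6 h => ⟨by omega, by omega⟩⟩,
    ⟨by norm_num, by norm_num, fun f w hf hw h6 h => ⟨by omega, by omega⟩⟩,
    ⟨by norm_num, by norm_num, fun f w hf hw h6 h => ⟨by omega, by omega⟩⟩⟩

/-- **[XXXV] 5.1 (LEMMA P′-BUDGET, the numbers).** `|P′| = 2μ′ + 2(a₁ − n′)(a₂ − 2) − 4n′`; type 1 (`μ′ = 62`, `n′ = 10`):
`|P′| = 124 − 4a₁ − 20a₂ + 2a₁a₂`, e.g. `284` at `(20, 12)`, `282` at `(21, 11)`, `348` at `(21, 14)`. With `W′·S = 104` (`n₃ = 10`, `d₃ = 3`)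
and every S-line of multiplicity `≥ 2`: at least `|P′| − 104 + 2·(2·#lines)` points of `P′` lie on the lines — `216` for nine simple lines
at `(20, 12)`, `198` for one ninefold line (`m ≥ 9`). The per-line trace identity `ℓ′_z = 2(k_z + e_z) + z̄_z − v′` is the degree
bookkeeping `20 − a₁ − ℓ′ = 2n₄ − 2k − 2e − z̄` with `n₃ + n₄ = 10`, `v′ = a₁ − 2n₃`. [`ring` / `norm_num` / `linarith`] -/
theorem pg22_pprime_budget :
    (∀ a₁ a₂ : ℤ, 2 * 62 + 2 * (a₁ - 10) * (a₂ - 2) - 4 * 10 = 124 - 4 * a₁ - 20 * a₂ + 2 * a₁ * a₂) ∧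
    ((124 : ℤ) - 4 * 20 - 20 * 12 + 2 * 20 * 12 = 284 ∧ (124 : ℤ) - 4 * 21 - 20 * 11 + 2 * 21 * 11 = 282 ∧
      (124 : ℤ) - 4 * 21 - 20 * 14 + 2 * 21 * 14 = 348) ∧
    ((284 : ℤ) - 104 + 2 * (2 * 9) = 216 ∧ (284 : ℤ) - 104 + 2 * 9 = 198) ∧
    (∀ n₃ n₄ a₁ l k e z v : ℤ, n₃ + n₄ = 10 → v = a₁ - 2 * n₃ → 20 - a₁ - l = 2 * n₄ - 2 * k - 2 * e - z →
        l = 2 * (k + e) + z - v) := by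
  refine ⟨fun a₁ a₂ => by ring, by norm_num, by norm_num, fun n₃ n₄ a₁ l k e z v h1 h2 h3 => by linarith⟩

/-- **[XXXV] 4.6 ((Q-RES-low) under SOC-direct: what the obstruction costs).** Type 1: `OB = (12 − 2n₃)²(2d₃ − 5)` for `2n₃ ≤ 11`, and a free
pair of vertical fibres outside `S` supplies `2d₃ − 5` invariant socle sections while costing `≥ 4` of `W′·f′ = 70 − 2n₃(10 − n₃)` (each fibre
multiple by MULT). `n₃ = 4`, `d₃ = 4`: `OB = 48`, `17` pairs would be needed (`17·3 ≥ 50 > 16·3`) but `4·17 > 22 = W′·f′`; `n₃ = 5`: `OB = 4(2d₃ − 5)`,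
five pairs needed and `4·5 = 20 = W′·f′` exactly; `n₃ = 6` (`OB ≤ 2d₃ − 5`): two pairs suffice: `2(2d₃ − 5) ≥ (2d₃ − 5) + 2` for `d₃ ≥ 4`. [`norm_num`/`omega`] -/
theorem pg22_low_pairs :
    (((12 : ℤ) - 2 * 4) ^ 2 * (2 * 4 - 5) = 48 ∧ (17 : ℤ) * 3 ≥ 48 + 2 ∧ (16 : ℤ) * 3 < 48 + 2 ∧ (4 : ℤ) * 17 > 70 - 2 * 4 * (10 - 4)) ∧
    (∀ d₃ : ℤ, ((12 : ℤ) - 2 * 5) ^ 2 * (2 * d₃ - 5) = 4 * (2 * d₃ - 5)) ∧ ((70 : ℤ) - 2 * 5 * (10 - 5) = 4 * 5) ∧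
    (∀ d₃ : ℤ, 4 ≤ d₃ → (2 * d₃ - 5) + 2 ≤ 2 * (2 * d₃ - 5)) := by
  refine ⟨by norm_num, fun d₃ => by ring, by norm_num, fun d₃ h => by omega⟩

end ProductGroundTwentyTwo

end Summit.HodgeConjecture.HodgeConjecture.WeilTypeLadder
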